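import Summits.QuantumFields.BalabanUV.Beta.MultiscaleHessianIdentity

/-!
# `Summit.QuantumFields.BalabanUV.Beta.MultiscaleHessianCommutator` — engine file 22c: LOCALISING THE HESSIAN ENERGY WITH A C² CUTOFF —
# for FLAT transport and a CONSTANT bond weight, any `χ : UT N → ℝ` with `|χ| ≤ 1`, `|δχ| ≤ θ₁`, `|δδχ| ≤ θ₂`, `χ = 1` on the box
# `dist(·,x₀) ≤ ρ₁` and `χ = 0` off `dist(·,x₀) ≤ r`, and any field `w`:
# `c₀²·Σ_{x : dist(x,x₀)+2 ≤ ρ₁} Σ_{μνi}(δ_νD_μ w)² ≤ 3‖1_{U}D*Dw‖² + 3d²c₀⁴θ₂²‖1_{U}w‖² + 12dc₀²θ₁²‖1_{U}Dw‖²`, `U = {dist(·,x₀) ≤ r+2}`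
# — the torus Hessian identity of file 22a applied to `χw` plus the second-order Leibniz commutator `[D*D, χ]` (programme «HESSIAN-L2-FLAT»)

HONEST FRAMING (page 1 of everything in this cell).  Discharging `FlowStep.BetaPertH` would make Bałaban's ultraviolet
stability UNCONDITIONAL — a constructive-QFT result; it is NOT the continuum limit and NOT the Clay problem.  This module
discharges nothing of `BetaPertH`; it is [folklore] lattice calculus, kernel-checked, by the OWNER of binder row D4 (unit
`b2b-balaban-beta-an4`, gen 47).  HONEST DEPENDENCY: continuum YM on T⁴ ⇐ BetaPertH ∧ nine spine estimates (0/9 proved); BetaPertH ⇐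
(D1) ∧ (D4) ∧ CAP+tail; G-an2-4 gates asym, D1 and NE2/3/4.

THE POINT (O.2 item (i), MODEL level; NOT the critical path).  The pure second-order ℓ² member (3.46)₄ «‖h∇_U∇_UG′(U)λ‖ ≤ B₀·1·|h|…»
asks for the Hessian energy of `w = (levelOp)⁻¹u` ON ONE CELL.  File 22a turns the GLOBAL Hessian energy into `‖D*D·‖²/c₀²`; to
localise, multiply by a cutoff: with `(D*D f)(x,i) = −c₀²Σ_ν(f(x+e_ν,i) − 2f(x,i) + f(x−e_ν,i))` (`covLap_flat_const`),
`D*D(χw) − χ·D*Dw = −c₀²Σ_ν[(δδ_νχ)(x)·w(x+e_ν) + (χ(x−e_ν) − χ(x))·(w(x−e_ν) − w(x+e_ν))]` (`covLap_mul_sub`) — the symmetric part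
carries the SECOND difference of `χ` against `w`, the antisymmetric part a FIRST difference of `χ` against a first difference of `w`;
this is why the cutoff must be C² (`θ₂ ~ s⁻²` pairs with `‖w‖ ~ s²`, `θ₁ ~ s⁻¹` with `‖Dw‖ ~ s`; file 22b supplies `θ₁ = 1/s`,
`θ₂ = 2/s²`).  Squaring with `(a+b+c)² ≤ 3(a²+b²+c²)` and Cauchy–Schwarz over the `d` directions, re-indexing the shifted sums by the
torus translations (`sum_up_eq`∕`sum_dn_eq` of 22a in the form `Σ_{x ∈ U} g(x ± e_ν) ≤ Σ_{y ∈ U′} g(y)`, `U′` one step larger), and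
observing that `D*D(χw)` vanishes one step outside the support of `χ`, gives **`sum_sq_covLap_mul_le`**.  Where `χ = 1` two steps around
`x` the mixed second difference of `χw` is that of `w` (`hessian_mul_eq`), so 22a's `sum_cell_hessian_le` yields the END
**`cell_hessian_le_of_cutoff`**.  Everything here is uniform in `w` (no equation is used) and in `χ` (abstract bounds `θ₁, θ₂`).

WHAT IS CERTIFIED (kernel, 0 sorry, 0 def): `covLap_mul_sub`, `abs_covLap_mul_le`, `covLap_mul_eq_zero_of_far`, `sum_shift_up_le`,
`sum_shift_dn_le`, **`sum_sq_covLap_mul_le`**, `hessian_mul_eq`, **`cell_hessian_le_of_cutoff`**.  LOCATORS (shape only; ABSOLUTE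
RULE — nothing printed is asserted): [Balaban1985BackgroundPropagators] Thm 3.1 (3.46) p. 398, (3.88) p. 409 (the Leibniz commutator
`K(h)`); [Balaban1984PropagatorsII] (2.39) p. 229.  Row D4: NO class change (critical-path width 0; D4 DISCHARGE NO DATE); NOT BetaPertH,
NOT continuum, NOT Clay, NOT summit progress.
-/

open scoped BigOperators
open Finset

namespace Summit.QuantumFields.BalabanUV.Beta.MultiscaleHessianCommutator

open Summit.QuantumFields.BalabanUV.Beta.MultiscaleHessianIdentity (covLap_flat_const sum_up_eq sum_dn_eq sum_cell_hessian_le)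
open Summit.QuantumFields.BalabanUV.Beta.MultiscaleGradientSource (covD_flat)
open Summit.QuantumFields.BalabanUV.Beta.HarmonicGradientInterior (up_up_comm dist_up_le_add_one)
open Literature.MathematicalPhysics.QuantumFieldTheory.Balaban1983to89
open Literature.MathematicalPhysics.QuantumFieldTheory.Balaban1983to89.B9Thm37Glue (covD covDT)
open Literature.MathematicalPhysics.QuantumFieldTheory.Balaban1983to89.B9Thm37GluePU (bsrc btgt bsrc_apply btgt_apply)
open Literature.MathematicalPhysics.QuantumFieldTheory.Balaban1983to89.B9Thm37GlueTorusCovCT (up_injective)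
open B5TorusCover (UT)
open B5Leibniz121 (up dn up_dn dist_dn_le)
open B5DirichletDg (dn_up)

noncomputable section

variable {d : ℕ} {N : Fin d → ℕ} [∀ i, NeZero (N i)] {Cp : Type} [Fintype Cp] [DecidableEq Cp]
  {Rm : UT N × Fin d → Cp → Cp → ℝ} (hflat : ∀ b k i, Rm b k i = if k = i then 1 else 0)
  {c : UT N × Fin d → ℝ} {c₀ : ℝ} (hcc : ∀ b, c b = c₀)

/-! ## §1 The second-order Leibniz commutator, pointwise -/

include hflat hcc in
/-- **`[D*D, χ]` in flat∕constant form**: `D*D(χw)(x,i) − χ(x)·D*Dw(x,i) =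
−c₀²Σ_ν[(χ(x+e_ν) − 2χ(x) + χ(x−e_ν))·w(x+e_ν,i) + (χ(x−e_ν) − χ(x))·(w(x−e_ν,i) − w(x+e_ν,i))]`.
[cite: Balaban1985BackgroundPropagators, (3.88) p.409; Balaban1984PropagatorsII, (2.39) p.229] [folklore] -/
theorem covLap_mul_sub (χ : UT N → ℝ) (w : UT N × Cp → ℝ) (x : UT N) (i : Cp) :
    covDT bsrc btgt c Rm (covD bsrc btgt c Rm (fun p => χ p.1 * w p)) (x, i) -
        χ x * covDT bsrc btgt c Rm (covD bsrc btgt c Rm w) (x, i) =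
      -(c₀ ^ 2 * ∑ ν, ((χ (up x ν) - 2 * χ x + χ (dn x ν)) * w (up x ν, i) +
        (χ (dn x ν) - χ x) * (w (dn x ν, i) - w (up x ν, i)))) := by
  rw [covLap_flat_const hflat hcc, covLap_flat_const hflat hcc]
  dsimp only
  rw [show ∀ A B C : ℝ, -A - C * -B = -(A - C * B) from fun A B C => by ring]
  congr 1
  simp only [Finset.mul_sum, ← Finset.sum_sub_distrib]
  refine Finset.sum_congr rfl fun ν _ => ?_
  ring

include hflat hcc in
/-- **Pointwise bound**: with `|χ| ≤ 1`, `|χ(y+e_ν) − χ(y)| ≤ θ₁`, `|χ(y+e_ν) − 2χ(y) + χ(y−e_ν)| ≤ θ₂`: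
`|D*D(χw)(x,i)| ≤ |D*Dw(x,i)| + Σ_ν[c₀²θ₂|w(x+e_ν,i)| + |c₀|θ₁(|Dw((x−e_ν,ν),i)| + |Dw((x,ν),i)|)]`. [folklore] -/
theorem abs_covLap_mul_le (χ : UT N → ℝ) {θ₁ θ₂ : ℝ} (hθ₁ : 0 ≤ θ₁) (hχ1 : ∀ y, |χ y| ≤ 1)
    (hχd : ∀ y μ, |χ (up y μ) - χ y| ≤ θ₁) (hχdd : ∀ y μ, |χ (up y μ) - 2 * χ y + χ (dn y μ)| ≤ θ₂)
    (w : UT N × Cp → ℝ) (x : UT N) (i : Cp) :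
    |covDT bsrc btgt c Rm (covD bsrc btgt c Rm (fun p => χ p.1 * w p)) (x, i)| ≤
      |covDT bsrc btgt c Rm (covD bsrc btgt c Rm w) (x, i)| +
        ∑ ν, (c₀ ^ 2 * θ₂ * |w (up x ν, i)| +
          |c₀| * θ₁ * (|covD bsrc btgt c Rm w ((dn x ν, ν), i)| + |covD bsrc btgt c Rm w ((x, ν), i)|)) := by
  have e := covLap_mul_sub hflat hcc χ w x i
  rw [sub_eq_iff_eq_add] at e
  rw [e]
  refine (abs_add_le _ _).trans ?_
  rw [add_comm]
  refine add_le_add ?_ ?_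
  · rw [abs_mul]
    calc |χ x| * |covDT bsrc btgt c Rm (covD bsrc btgt c Rm w) (x, i)| ≤ 1 * |covDT bsrc btgt c Rm (covD bsrc btgt c Rm w) (x, i)| :=
          mul_le_mul_of_nonneg_right (hχ1 x) (abs_nonneg _)
      _ = _ := one_mul _
  · rw [abs_neg, abs_mul, abs_of_nonneg (sq_nonneg c₀)]
    calc c₀ ^ 2 * |∑ ν, ((χ (up x ν) - 2 * χ x + χ (dn x ν)) * w (up x ν, i) + (χ (dn x ν) - χ x) * (w (dn x ν, i) - w (up x ν, i)))|
        ≤ c₀ ^ 2 * ∑ ν, (θ₂ * |w (up x ν, i)| + θ₁ * (|w (dn x ν, i) - w (x, i)| + |w (up x ν, i) - w (x, i)|)) := by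
          refine mul_le_mul_of_nonneg_left ((Finset.abs_sum_le_sum_abs _ _).trans (Finset.sum_le_sum fun ν _ => ?_)) (sq_nonneg _)
          refine (abs_add_le _ _).trans (add_le_add ?_ ?_)
          · rw [abs_mul]; exact mul_le_mul_of_nonneg_right (hχdd x ν) (abs_nonneg _)
          · rw [abs_mul]
            have h1 : |χ (dn x ν) - χ x| ≤ θ₁ := by
              have := hχd (dn x ν) ν; rw [up_dn] at this; rwa [abs_sub_comm]
            have h2 : |w (dn x ν, i) - w (up x ν, i)| ≤ |w (dn x ν, i) - w (x, i)| + |w (up x ν, i) - w (x, i)| := by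
              rw [show w (dn x ν, i) - w (up x ν, i) = (w (dn x ν, i) - w (x, i)) - (w (up x ν, i) - w (x, i)) by ring]
              exact abs_sub _ _
            exact mul_le_mul h1 h2 (abs_nonneg _) hθ₁
      _ = ∑ ν, (c₀ ^ 2 * θ₂ * |w (up x ν, i)| + |c₀| * θ₁ * (|covD bsrc btgt c Rm w ((dn x ν, ν), i)| + |covD bsrc btgt c Rm w ((x, ν), i)|)) := by
          rw [Finset.mul_sum]
          refine Finset.sum_congr rfl fun ν _ => ?_
          rw [covD_flat hflat c w (dn x ν, ν) i, covD_flat hflat c w (x, ν) i, hcc, hcc, btgt_apply, bsrc_apply, btgt_apply,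
            bsrc_apply, up_dn, abs_mul, abs_mul, show w (dn x ν, i) - w (x, i) = -(w (x, i) - w (dn x ν, i)) by ring, abs_neg,
            show c₀ ^ 2 = |c₀| * |c₀| by rw [← abs_mul, ← sq, abs_of_nonneg (sq_nonneg _)]]
          ring

include hflat hcc in
/-- One step off the support of `χ` the Laplacian of `χw` vanishes: `χ = 0` off `dist(·,x₀) ≤ r` and `dist(x,x₀) > r + 1` ⟹
`D*D(χw)(x,i) = 0`. [folklore] -/
theorem covLap_mul_eq_zero_of_far (χ : UT N → ℝ) {x₀ : UT N} {r : ℝ} (hsupp : ∀ y, χ y ≠ 0 → dist y x₀ ≤ r)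
    (w : UT N × Cp → ℝ) {x : UT N} (hx : r + 1 < dist x x₀) (i : Cp) :
    covDT bsrc btgt c Rm (covD bsrc btgt c Rm (fun p => χ p.1 * w p)) (x, i) = 0 := by
  rw [covLap_flat_const hflat hcc]
  have h0 : ∀ y, r < dist y x₀ → χ y = 0 := fun y hy => by
    by_contra h; exact absurd (hsupp y h) (not_le.mpr hy)
  have hx0 : χ x = 0 := h0 x (by linarith)
  have hup : ∀ ν, χ (up x ν) = 0 := fun ν => h0 _ (by
    have := dist_up_le_add_one (dn (up x ν) ν) x₀ ν
    rw [up_dn] at this; rw [dn_up] at this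
    have h2 := dist_up_le_add_one x x₀ ν
    -- `dist(x,x₀) ≤ dist(x+e_ν,x₀) + 1`
    have h3 : dist x x₀ ≤ dist (up x ν) x₀ + 1 := by
      have t := dist_triangle x (up x ν) x₀
      have t2 := B5Leibniz121.dist_up_le x ν
      linarith
    linarith)
  have hdn : ∀ ν, χ (dn x ν) = 0 := fun ν => h0 _ (by
    have h3 : dist x x₀ ≤ dist (dn x ν) x₀ + 1 := by
      have t := dist_triangle x (dn x ν) x₀
      have t2 := dist_dn_le x ν
      linarith
    linarith)
  simp only [hx0, hup, hdn, zero_mul, mul_zero, sub_zero, add_zero, Finset.sum_const_zero, neg_zero]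

/-! ## §2 Shifted sums on the torus: `Σ_{x ∈ U} g(x ± e_ν) ≤ Σ_{y ∈ U′} g(y)` when `U ± e_ν ⊂ U′` -/

/-- `Σ_{x : dist(x,x₀) ≤ ρ} g(x + e_ν) ≤ Σ_{y : dist(y,x₀) ≤ ρ+1} g(y)` for `g ≥ 0`. [folklore] -/
theorem sum_shift_up_le (x₀ : UT N) (ρ : ℝ) (g : UT N → ℝ) (hg : ∀ y, 0 ≤ g y) (ν : Fin d) :
    ∑ x ∈ univ.filter (fun x : UT N => dist x x₀ ≤ ρ), g (up x ν) ≤ ∑ y ∈ univ.filter (fun y : UT N => dist y x₀ ≤ ρ + 1), g y := by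
  classical
  rw [← Finset.sum_image (f := g) (s := univ.filter (fun x : UT N => dist x x₀ ≤ ρ)) (g := fun x => up x ν)
    (fun x _ y _ h => up_injective ν h)]
  refine Finset.sum_le_sum_of_subset_of_nonneg (fun y hy => ?_) fun y _ _ => hg y
  obtain ⟨x, hx, rfl⟩ := Finset.mem_image.mp hy
  rw [mem_filter] at hx ⊢
  exact ⟨mem_univ _, (dist_up_le_add_one x x₀ ν).trans (by linarith [hx.2])⟩

/-- `Σ_{x : dist(x,x₀) ≤ ρ} g(x − e_ν) ≤ Σ_{y : dist(y,x₀) ≤ ρ+1} g(y)` for `g ≥ 0`. [folklore] -/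
theorem sum_shift_dn_le (x₀ : UT N) (ρ : ℝ) (g : UT N → ℝ) (hg : ∀ y, 0 ≤ g y) (ν : Fin d) :
    ∑ x ∈ univ.filter (fun x : UT N => dist x x₀ ≤ ρ), g (dn x ν) ≤ ∑ y ∈ univ.filter (fun y : UT N => dist y x₀ ≤ ρ + 1), g y := by
  classical
  have hinj : Function.Injective fun y : UT N => dn y ν := fun x y h => by
    have h' := congrArg (fun z => up z ν) h; simpa only [up_dn] using h'
  rw [← Finset.sum_image (f := g) (s := univ.filter (fun x : UT N => dist x x₀ ≤ ρ)) (g := fun x => dn x ν)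
    (fun x _ y _ h => hinj h)]
  refine Finset.sum_le_sum_of_subset_of_nonneg (fun y hy => ?_) fun y _ _ => hg y
  obtain ⟨x, hx, rfl⟩ := Finset.mem_image.mp hy
  rw [mem_filter] at hx ⊢
  have h3 : dist (dn x ν) x₀ ≤ dist x x₀ + 1 := by
    have t := dist_triangle (dn x ν) x x₀
    have t2 := dist_dn_le x ν
    rw [dist_comm x (dn x ν)] at t2
    linarith
  exact ⟨mem_univ _, h3.trans (by linarith [hx.2])⟩

/-! ## §3 The ℓ² bound of `D*D(χw)` -/

include hflat hcc in
/-- **THE ℓ² BOUND OF `D*D(χw)`.**  Flat transport, constant weight; `χ` with `|χ| ≤ 1`, `|δχ| ≤ θ₁`, `|δδχ| ≤ θ₂` (along every axis)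
and `χ = 0` off `dist(·,x₀) ≤ r`; `U = {dist(·,x₀) ≤ r+2}`.  Then for every field `w`:
`Σ_p (D*D(χw))(p)² ≤ 3·Σ_{x∈U,i}(D*Dw)² + 3d²c₀⁴θ₂²·Σ_{x∈U,i} w² + 12dc₀²θ₁²·Σ_{x∈U}Σ_{ν,i}(Dw((x,ν),i))²`. [folklore] -/
theorem sum_sq_covLap_mul_le (χ : UT N → ℝ) {θ₁ θ₂ : ℝ} (hθ₁ : 0 ≤ θ₁) (hχ1 : ∀ y, |χ y| ≤ 1)
    (hχd : ∀ y μ, |χ (up y μ) - χ y| ≤ θ₁) (hχdd : ∀ y μ, |χ (up y μ) - 2 * χ y + χ (dn y μ)| ≤ θ₂)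
    {x₀ : UT N} {r : ℝ} (hsupp : ∀ y, χ y ≠ 0 → dist y x₀ ≤ r) (w : UT N × Cp → ℝ) :
    ∑ p : UT N × Cp, (covDT bsrc btgt c Rm (covD bsrc btgt c Rm (fun p => χ p.1 * w p)) p) ^ 2 ≤
      3 * ∑ x ∈ univ.filter (fun x : UT N => dist x x₀ ≤ r + 2), ∑ i, (covDT bsrc btgt c Rm (covD bsrc btgt c Rm w) (x, i)) ^ 2 +
        3 * d ^ 2 * c₀ ^ 4 * θ₂ ^ 2 * ∑ x ∈ univ.filter (fun x : UT N => dist x x₀ ≤ r + 2), ∑ i, w (x, i) ^ 2 +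
        12 * d * c₀ ^ 2 * θ₁ ^ 2 *
          ∑ x ∈ univ.filter (fun x : UT N => dist x x₀ ≤ r + 2), ∑ ν, ∑ i, (covD bsrc btgt c Rm w ((x, ν), i)) ^ 2 := by
  classical
  -- abbreviations
  set Lw : UT N × Cp → ℝ := fun p => covDT bsrc btgt c Rm (covD bsrc btgt c Rm w) p with hLw
  set Lg : UT N × Cp → ℝ := fun p => covDT bsrc btgt c Rm (covD bsrc btgt c Rm (fun p => χ p.1 * w p)) p with hLg
  set Dw : (UT N × Fin d) × Cp → ℝ := fun q => covD bsrc btgt c Rm w q with hDw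
  set U1 := univ.filter (fun x : UT N => dist x x₀ ≤ r + 1) with hU1
  set U2 := univ.filter (fun x : UT N => dist x x₀ ≤ r + 2) with hU2
  have hd0 : (0 : ℝ) ≤ d := Nat.cast_nonneg _
  -- (1) restrict the full sum to `U1` (outside, `Lg = 0`)
  have hzero : ∀ x, x ∉ U1 → ∀ i, Lg (x, i) = 0 := fun x hx i => by
    have hx' : r + 1 < dist x x₀ := by
      by_contra h; exact hx (by rw [hU1, mem_filter]; exact ⟨mem_univ _, not_lt.mp h⟩)
    exact covLap_mul_eq_zero_of_far hflat hcc χ hsupp w hx' i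
  have hrestrict : ∑ p : UT N × Cp, Lg p ^ 2 = ∑ x ∈ U1, ∑ i, Lg (x, i) ^ 2 := by
    rw [Fintype.sum_prod_type]
    symm
    refine Finset.sum_subset (Finset.subset_univ U1) fun x _ hx => ?_
    exact Finset.sum_eq_zero fun i _ => by rw [hzero x hx i]; ring
  -- (2) the pointwise bound, squared and expanded
  have hpt : ∀ x i, Lg (x, i) ^ 2 ≤ 3 * Lw (x, i) ^ 2 + (3 * d * (c₀ ^ 2 * θ₂) ^ 2) * ∑ ν, w (up x ν, i) ^ 2 +
      (6 * d * (|c₀| * θ₁) ^ 2) * ∑ ν, Dw ((dn x ν, ν), i) ^ 2 + (6 * d * (|c₀| * θ₁) ^ 2) * ∑ ν, Dw ((x, ν), i) ^ 2 := by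
    intro x i
    have h := abs_covLap_mul_le hflat hcc χ hθ₁ hχ1 hχd hχdd w x i
    simp only [← hLg, ← hDw] at h
    -- name the three pieces
    set A := |Lw (x, i)| with hA
    set B := ∑ ν, |w (up x ν, i)| with hB
    set E := ∑ ν, (|Dw ((dn x ν, ν), i)| + |Dw ((x, ν), i)|) with hE
    have hsplit : ∑ ν, (c₀ ^ 2 * θ₂ * |w (up x ν, i)| + |c₀| * θ₁ * (|Dw ((dn x ν, ν), i)| + |Dw ((x, ν), i)|)) =
        c₀ ^ 2 * θ₂ * B + |c₀| * θ₁ * E := by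
      rw [Finset.sum_add_distrib, ← Finset.mul_sum, ← Finset.mul_sum]
    rw [hsplit] at h
    have hB0 : 0 ≤ B := Finset.sum_nonneg fun ν _ => abs_nonneg _
    have hE0 : 0 ≤ E := Finset.sum_nonneg fun ν _ => add_nonneg (abs_nonneg _) (abs_nonneg _)
    have h2 : Lg (x, i) ^ 2 ≤ (A + c₀ ^ 2 * θ₂ * B + |c₀| * θ₁ * E) ^ 2 := by
      rw [← sq_abs (Lg (x, i)), add_assoc]
      exact pow_le_pow_left₀ (abs_nonneg _) h 2
    have h3 : (A + c₀ ^ 2 * θ₂ * B + |c₀| * θ₁ * E) ^ 2 ≤ 3 * (A ^ 2 + (c₀ ^ 2 * θ₂ * B) ^ 2 + (|c₀| * θ₁ * E) ^ 2) := by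
      nlinarith [sq_nonneg (A - c₀ ^ 2 * θ₂ * B), sq_nonneg (c₀ ^ 2 * θ₂ * B - |c₀| * θ₁ * E), sq_nonneg (A - |c₀| * θ₁ * E)]
    -- Cauchy–Schwarz over the directions
    have hBsq : B ^ 2 ≤ d * ∑ ν, w (up x ν, i) ^ 2 := by
      have hcs := sq_sum_le_card_mul_sum_sq (s := (univ : Finset (Fin d))) (f := fun ν => |w (up x ν, i)|)
      simp only [Finset.card_univ, Fintype.card_fin, sq_abs] at hcs
      rw [hB]; exact hcs
    have hEsq : E ^ 2 ≤ 2 * d * (∑ ν, Dw ((dn x ν, ν), i) ^ 2 + ∑ ν, Dw ((x, ν), i) ^ 2) := by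
      have hcs := sq_sum_le_card_mul_sum_sq (s := (univ : Finset (Fin d))) (f := fun ν => |Dw ((dn x ν, ν), i)| + |Dw ((x, ν), i)|)
      simp only [Finset.card_univ, Fintype.card_fin] at hcs
      have h4 : ∑ ν, (|Dw ((dn x ν, ν), i)| + |Dw ((x, ν), i)|) ^ 2 ≤ ∑ ν, 2 * (Dw ((dn x ν, ν), i) ^ 2 + Dw ((x, ν), i) ^ 2) :=
        Finset.sum_le_sum fun ν _ => by
          have := sq_nonneg (|Dw ((dn x ν, ν), i)| - |Dw ((x, ν), i)|)
          nlinarith [sq_abs (Dw ((dn x ν, ν), i)), sq_abs (Dw ((x, ν), i))]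
      rw [hE]
      calc (∑ ν, (|Dw ((dn x ν, ν), i)| + |Dw ((x, ν), i)|)) ^ 2 ≤ d * ∑ ν, (|Dw ((dn x ν, ν), i)| + |Dw ((x, ν), i)|) ^ 2 := hcs
        _ ≤ d * ∑ ν, 2 * (Dw ((dn x ν, ν), i) ^ 2 + Dw ((x, ν), i) ^ 2) := mul_le_mul_of_nonneg_left h4 hd0
        _ = 2 * d * (∑ ν, Dw ((dn x ν, ν), i) ^ 2 + ∑ ν, Dw ((x, ν), i) ^ 2) := by
            rw [← Finset.mul_sum, Finset.sum_add_distrib]; ring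
    have hA2 : A ^ 2 = Lw (x, i) ^ 2 := sq_abs _
    have h5 := mul_le_mul_of_nonneg_left hBsq (sq_nonneg (c₀ ^ 2 * θ₂))
    have h6 := mul_le_mul_of_nonneg_left hEsq (sq_nonneg (|c₀| * θ₁))
    nlinarith [h2, h3, h5, h6, hA2]
  -- (3) sum over `U1 × Cp` and re-index the shifted sums into `U2`
  have hw0 : ∀ y i, 0 ≤ w (y, i) ^ 2 := fun y i => sq_nonneg _
  have hshiftB : ∀ i ν, ∑ x ∈ U1, w (up x ν, i) ^ 2 ≤ ∑ y ∈ U2, w (y, i) ^ 2 := fun i ν => by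
    have h := sum_shift_up_le x₀ (r + 1) (fun y => w (y, i) ^ 2) (fun y => hw0 y i) ν
    rw [show r + 1 + 1 = r + 2 by ring] at h; exact h
  have hshiftC : ∀ i ν, ∑ x ∈ U1, Dw ((dn x ν, ν), i) ^ 2 ≤ ∑ y ∈ U2, Dw ((y, ν), i) ^ 2 := fun i ν => by
    have h := sum_shift_dn_le x₀ (r + 1) (fun y => Dw ((y, ν), i) ^ 2) (fun y => sq_nonneg _) ν
    rw [show r + 1 + 1 = r + 2 by ring] at h; exact h
  have hU12 : U1 ⊆ U2 := fun x hx => by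
    rw [hU1, mem_filter] at hx; rw [hU2, mem_filter]; exact ⟨mem_univ _, by linarith [hx.2]⟩
  -- the four aggregated quantities
  have hT0 : ∑ x ∈ U1, ∑ i, Lw (x, i) ^ 2 ≤ ∑ x ∈ U2, ∑ i, Lw (x, i) ^ 2 :=
    Finset.sum_le_sum_of_subset_of_nonneg hU12 fun _ _ _ => Finset.sum_nonneg fun _ _ => sq_nonneg _
  have hT1 : ∑ x ∈ U1, ∑ i, ∑ ν, w (up x ν, i) ^ 2 ≤ d * ∑ x ∈ U2, ∑ i, w (x, i) ^ 2 := by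
    calc ∑ x ∈ U1, ∑ i, ∑ ν, w (up x ν, i) ^ 2 = ∑ i, ∑ ν, ∑ x ∈ U1, w (up x ν, i) ^ 2 := by
          rw [Finset.sum_comm]; exact Finset.sum_congr rfl fun i _ => Finset.sum_comm
      _ ≤ ∑ i, ∑ _ν : Fin d, ∑ y ∈ U2, w (y, i) ^ 2 := Finset.sum_le_sum fun i _ => Finset.sum_le_sum fun ν _ => hshiftB i ν
      _ = ∑ i, (d : ℝ) * ∑ y ∈ U2, w (y, i) ^ 2 := Finset.sum_congr rfl fun i _ => by
          rw [Finset.sum_const, Finset.card_univ, Fintype.card_fin, nsmul_eq_mul]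
      _ = d * ∑ x ∈ U2, ∑ i, w (x, i) ^ 2 := by rw [← Finset.mul_sum, Finset.sum_comm]
  have hT2 : ∑ x ∈ U1, ∑ i, ∑ ν, Dw ((dn x ν, ν), i) ^ 2 ≤ ∑ x ∈ U2, ∑ ν, ∑ i, Dw ((x, ν), i) ^ 2 := by
    calc ∑ x ∈ U1, ∑ i, ∑ ν, Dw ((dn x ν, ν), i) ^ 2 = ∑ i, ∑ ν, ∑ x ∈ U1, Dw ((dn x ν, ν), i) ^ 2 := by
          rw [Finset.sum_comm]; exact Finset.sum_congr rfl fun i _ => Finset.sum_comm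
      _ ≤ ∑ i, ∑ ν, ∑ y ∈ U2, Dw ((y, ν), i) ^ 2 := Finset.sum_le_sum fun i _ => Finset.sum_le_sum fun ν _ => hshiftC i ν
      _ = ∑ x ∈ U2, ∑ ν, ∑ i, Dw ((x, ν), i) ^ 2 := by
          rw [Finset.sum_comm]
          exact (Finset.sum_congr rfl fun ν _ => Finset.sum_comm).trans Finset.sum_comm
  have hT3 : ∑ x ∈ U1, ∑ i, ∑ ν, Dw ((x, ν), i) ^ 2 ≤ ∑ x ∈ U2, ∑ ν, ∑ i, Dw ((x, ν), i) ^ 2 := by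
    calc ∑ x ∈ U1, ∑ i, ∑ ν, Dw ((x, ν), i) ^ 2 ≤ ∑ x ∈ U2, ∑ i, ∑ ν, Dw ((x, ν), i) ^ 2 :=
          Finset.sum_le_sum_of_subset_of_nonneg hU12 fun _ _ _ =>
            Finset.sum_nonneg fun _ _ => Finset.sum_nonneg fun _ _ => sq_nonneg _
      _ = ∑ x ∈ U2, ∑ ν, ∑ i, Dw ((x, ν), i) ^ 2 := Finset.sum_congr rfl fun x _ => Finset.sum_comm
  -- assemble
  rw [hrestrict]
  have hstep : ∑ x ∈ U1, ∑ i, Lg (x, i) ^ 2 ≤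
      3 * ∑ x ∈ U1, ∑ i, Lw (x, i) ^ 2 + (3 * d * (c₀ ^ 2 * θ₂) ^ 2) * ∑ x ∈ U1, ∑ i, ∑ ν, w (up x ν, i) ^ 2 +
      (6 * d * (|c₀| * θ₁) ^ 2) * ∑ x ∈ U1, ∑ i, ∑ ν, Dw ((dn x ν, ν), i) ^ 2 +
      (6 * d * (|c₀| * θ₁) ^ 2) * ∑ x ∈ U1, ∑ i, ∑ ν, Dw ((x, ν), i) ^ 2 := by
    calc ∑ x ∈ U1, ∑ i, Lg (x, i) ^ 2
        ≤ ∑ x ∈ U1, ∑ i, (3 * Lw (x, i) ^ 2 + (3 * d * (c₀ ^ 2 * θ₂) ^ 2) * ∑ ν, w (up x ν, i) ^ 2 +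
            (6 * d * (|c₀| * θ₁) ^ 2) * ∑ ν, Dw ((dn x ν, ν), i) ^ 2 + (6 * d * (|c₀| * θ₁) ^ 2) * ∑ ν, Dw ((x, ν), i) ^ 2) :=
          Finset.sum_le_sum fun x _ => Finset.sum_le_sum fun i _ => hpt x i
      _ = _ := by simp only [Finset.sum_add_distrib, ← Finset.mul_sum]
  have k1 : 0 ≤ 3 * d * (c₀ ^ 2 * θ₂) ^ 2 := by positivity
  have k2 : 0 ≤ 6 * d * (|c₀| * θ₁) ^ 2 := by positivity
  have m1 := mul_le_mul_of_nonneg_left hT1 k1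
  have m2 := mul_le_mul_of_nonneg_left hT2 k2
  have m3 := mul_le_mul_of_nonneg_left hT3 k2
  have habs : |c₀| ^ 2 = c₀ ^ 2 := sq_abs c₀
  have e1 : (3 * d * (c₀ ^ 2 * θ₂) ^ 2) * (d * ∑ x ∈ U2, ∑ i, w (x, i) ^ 2) =
      3 * d ^ 2 * c₀ ^ 4 * θ₂ ^ 2 * ∑ x ∈ U2, ∑ i, w (x, i) ^ 2 := by ring
  have e2 : (6 * d * (|c₀| * θ₁) ^ 2) * ∑ x ∈ U2, ∑ ν, ∑ i, Dw ((x, ν), i) ^ 2 +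
      (6 * d * (|c₀| * θ₁) ^ 2) * ∑ x ∈ U2, ∑ ν, ∑ i, Dw ((x, ν), i) ^ 2 =
      12 * d * c₀ ^ 2 * θ₁ ^ 2 * ∑ x ∈ U2, ∑ ν, ∑ i, Dw ((x, ν), i) ^ 2 := by rw [mul_pow, habs]; ring
  linarith [hstep, hT0, m1, m2, m3, e1, e2]

/-! ## §4 Where `χ = 1` the Hessian of `χw` is the Hessian of `w`; the END -/

include hflat in
/-- Two steps inside the region `χ = 1` the mixed second difference of `χw` is that of `w`. [folklore] -/
theorem hessian_mul_eq (χ : UT N → ℝ) {x₀ : UT N} {ρ₁ : ℝ} (hone : ∀ y, dist y x₀ ≤ ρ₁ → χ y = 1) (w : UT N × Cp → ℝ)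
    {x : UT N} (hx : dist x x₀ + 2 ≤ ρ₁) (μ ν : Fin d) (i : Cp) :
    covD bsrc btgt c Rm (fun p => χ p.1 * w p) ((up x ν, μ), i) - covD bsrc btgt c Rm (fun p => χ p.1 * w p) ((x, μ), i) =
      covD bsrc btgt c Rm w ((up x ν, μ), i) - covD bsrc btgt c Rm w ((x, μ), i) := by
  have h0 : χ x = 1 := hone x (by linarith)
  have h1 : χ (up x μ) = 1 := hone _ ((dist_up_le_add_one x x₀ μ).trans (by linarith))
  have h2 : χ (up x ν) = 1 := hone _ ((dist_up_le_add_one x x₀ ν).trans (by linarith))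
  have h3 : χ (up (up x ν) μ) = 1 :=
    hone _ ((dist_up_le_add_one _ x₀ μ).trans (by linarith [dist_up_le_add_one x x₀ ν]))
  simp only [covD_flat hflat, btgt_apply, bsrc_apply, h0, h1, h2, h3, one_mul]

include hflat hcc in
/-- **THE END OF FILE 22c — the Hessian energy of `w` on a set two steps inside `{χ = 1}` is controlled by `D*Dw`, `w`, `Dw` on the box
two steps outside the support of `χ`:**  flat transport, constant weight `c₀`; `χ` with `|χ| ≤ 1`, `|δχ| ≤ θ₁`, `|δδχ| ≤ θ₂`, `χ = 1` on
`dist(·,x₀) ≤ ρ₁`, `χ = 0` off `dist(·,x₀) ≤ r`; `P ⊂ {x : dist(x,x₀)+2 ≤ ρ₁}`; `U = {dist(·,x₀) ≤ r+2}`.  Then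
`c₀²·Σ_{x∈P}Σ_{μ,ν,i}((Dw)((x+e_ν,μ),i) − (Dw)((x,μ),i))² ≤ 3‖1_U D*Dw‖² + 3d²c₀⁴θ₂²‖1_U w‖² + 12dc₀²θ₁²‖1_U Dw‖²`.
[cite: Balaban1985BackgroundPropagators, Thm 3.1 (3.46) p.398] [folklore] -/
theorem cell_hessian_le_of_cutoff (χ : UT N → ℝ) {θ₁ θ₂ : ℝ} (hθ₁ : 0 ≤ θ₁) (hχ1 : ∀ y, |χ y| ≤ 1)
    (hχd : ∀ y μ, |χ (up y μ) - χ y| ≤ θ₁) (hχdd : ∀ y μ, |χ (up y μ) - 2 * χ y + χ (dn y μ)| ≤ θ₂)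
    {x₀ : UT N} {ρ₁ r : ℝ} (hone : ∀ y, dist y x₀ ≤ ρ₁ → χ y = 1) (hsupp : ∀ y, χ y ≠ 0 → dist y x₀ ≤ r)
    (w : UT N × Cp → ℝ) (P : Finset (UT N)) (hP : ∀ x ∈ P, dist x x₀ + 2 ≤ ρ₁) :
    c₀ ^ 2 * ∑ x ∈ P, ∑ μ : Fin d, ∑ ν : Fin d, ∑ i : Cp,
        (covD bsrc btgt c Rm w ((up x ν, μ), i) - covD bsrc btgt c Rm w ((x, μ), i)) ^ 2 ≤
      3 * ∑ x ∈ univ.filter (fun x : UT N => dist x x₀ ≤ r + 2), ∑ i, (covDT bsrc btgt c Rm (covD bsrc btgt c Rm w) (x, i)) ^ 2 +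
        3 * d ^ 2 * c₀ ^ 4 * θ₂ ^ 2 * ∑ x ∈ univ.filter (fun x : UT N => dist x x₀ ≤ r + 2), ∑ i, w (x, i) ^ 2 +
        12 * d * c₀ ^ 2 * θ₁ ^ 2 *
          ∑ x ∈ univ.filter (fun x : UT N => dist x x₀ ≤ r + 2), ∑ ν, ∑ i, (covD bsrc btgt c Rm w ((x, ν), i)) ^ 2 := by
  have heq : ∑ x ∈ P, ∑ μ : Fin d, ∑ ν : Fin d, ∑ i : Cp,
        (covD bsrc btgt c Rm w ((up x ν, μ), i) - covD bsrc btgt c Rm w ((x, μ), i)) ^ 2 =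
      ∑ x ∈ P, ∑ μ : Fin d, ∑ ν : Fin d, ∑ i : Cp,
        (covD bsrc btgt c Rm (fun p => χ p.1 * w p) ((up x ν, μ), i) - covD bsrc btgt c Rm (fun p => χ p.1 * w p) ((x, μ), i)) ^ 2 :=
    Finset.sum_congr rfl fun x hx => Finset.sum_congr rfl fun μ _ => Finset.sum_congr rfl fun ν _ =>
      Finset.sum_congr rfl fun i _ => by rw [hessian_mul_eq hflat χ hone w (hP x hx) μ ν i]
  rw [heq]
  exact (sum_cell_hessian_le hflat hcc _ P).trans (sum_sq_covLap_mul_le hflat hcc χ hθ₁ hχ1 hχd hχdd hsupp w)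

end

end Summit.QuantumFields.BalabanUV.Beta.MultiscaleHessianCommutator
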